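import Summits.Ventures.PercRepro.RankLevelSetCorankFiveCounts
import Summits.Ventures.PercRepro.RankLevelSetPlaneFan

/-!
# PercRepro — the plane-section counts on the core of corank `5` (night-1, gen 2; sharp `d = 5`, part 1 of 3)

RankLevelSetCorankFive closed the `d = 5` cell for `p ≥ 31` with the crude count `C(20,5)` for the `5`-sets of rank
`3`. Here the plane-section counting of dossier §13.4 replaces it: a `5`-set `B` of rank `3` on the core either
contains a `4`-circuit `C` (then `B = C ∪ {x}` with `x` one of the `≤ 3` further points of the `≤ 7`-point plane of
`C`) or contains a triangle `ℓ` (then `B` lies in one of the `≤ ν − 1` plane sections with `≥ 5` points through `ℓ`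
— the fan lemma of RankLevelSetPlaneFan — and is `ℓ` plus one of the `≤ C(4,2) = 6` pairs of that section). So
`A₅ ≤ 3·s₄ + 6·(ν − 1)·s₃ ≤ 3·70 + 6·4·25 = 810`, and the `6`- and `7`-sets of rank `3` number at most `2·A₅` each
(one more point of the plane each time): the sets of rank `≤ 3` with `≥ 5` points number at most `4050`.

* `ncard_le_three_of_eRk_le_two`, `eRk_eq_three_of_four_le` — on the core, `≥ 4` points of rank `≤ 3` have rank `3`;
* `ncard_insert_le_of_eRk_three` — one-point extensions inside the plane: `≤ (7 − k)` per rank-`3` `k`-set;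
* `exists_triangle_subset_of_no_four_circuit` — a `5`-set of rank `3` without a `4`-circuit contains a triangle;
* **`ncard_fiveSets_through_triangle_le`** — the fan count: `≤ 6·(ν − 1)` five-sets through a triangle.
Axioms: standard.
-/

namespace PercRepro

namespace Matroid

open Set

variable {α : Type} {M : _root_.Matroid α}

/-- On the core a set of rank `≤ 2` has at most `3` points ((C1) and the rank-`≤ 1` case). -/
theorem ncard_le_three_of_eRk_le_two [M.Finite]
    (hs : ∀ e ∈ M.E, ∀ f ∈ M.E, e ≠ f → M.eRk {e, f} = 2)
    (hfree : ∀ e ∈ M.E, ∃ A ⊆ M.E \ {e}, e ∉ M.closure A ∧ e ∉ M.closure ((M.E \ {e}) \ A))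
    {X : Set α} (hX : X ⊆ M.E) (hr : M.eRk X ≤ 2) : X.ncard ≤ 3 := by
  rcases hr.lt_or_eq with h | h
  · have h1 : M.eRk X ≤ 1 := by
      have h2 : (2 : ℕ∞) = 1 + 1 := by norm_num
      rw [h2, ENat.lt_add_one_iff (by simp)] at h
      exact h
    exact (ncard_le_one_of_eRk_le_one hs hX h1).trans (by norm_num)
  · exact ThmN.ncard_le_three_of_eRk_two M hs hfree hX h

/-- On the core a set with `≥ 4` points and rank `≤ 3` has rank exactly `3`. -/
theorem eRk_eq_three_of_four_le [M.Finite]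
    (hs : ∀ e ∈ M.E, ∀ f ∈ M.E, e ≠ f → M.eRk {e, f} = 2)
    (hfree : ∀ e ∈ M.E, ∃ A ⊆ M.E \ {e}, e ∉ M.closure A ∧ e ∉ M.closure ((M.E \ {e}) \ A))
    {B : Set α} (hB : B ⊆ M.E) (hr : M.eRk B ≤ 3) (h4 : 4 ≤ B.ncard) : M.eRk B = 3 := by
  rcases hr.lt_or_eq with h | h
  · have h2 : M.eRk B ≤ 2 := by
      have h3 : (3 : ℕ∞) = 2 + 1 := by norm_num
      rw [h3, ENat.lt_add_one_iff (by simp)] at h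
      exact h
    have := ncard_le_three_of_eRk_le_two hs hfree hB h2
    omega
  · exact h

/-- **One-point extensions inside the plane**: if `𝒜` is a family of rank-`3` sets with `k ≤ 7` elements, the sets
`B` with `k + 1` elements and rank `≤ 3` containing a member of `𝒜` number at most `(7 − k)·#𝒜` — `B = A ∪ {x}` with
`x ∈ cl(A) ∖ A`, a set of at most `7 − k` points by (C2). -/
theorem ncard_insert_le_of_eRk_three [M.Finite]
    (hs : ∀ e ∈ M.E, ∀ f ∈ M.E, e ≠ f → M.eRk {e, f} = 2)
    (hfree : ∀ e ∈ M.E, ∃ A ⊆ M.E \ {e}, e ∉ M.closure A ∧ e ∉ M.closure ((M.E \ {e}) \ A))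
    {k : ℕ} (𝒜 : Set (Set α)) (h𝒜fin : 𝒜.Finite)
    (h𝒜 : ∀ A ∈ 𝒜, A ⊆ M.E ∧ M.eRk A = 3 ∧ A.ncard = k) :
    {B : Set α | B ⊆ M.E ∧ B.ncard = k + 1 ∧ M.eRk B ≤ 3 ∧ ∃ A ∈ 𝒜, A ⊆ B}.ncard ≤
      (7 - k) * 𝒜.ncard := by
  classical
  have hclfin : ∀ A : Set α, (M.closure A \ A).Finite := fun A =>
    M.ground_finite.subset (Set.sdiff_subset.trans (M.closure_subset_ground A))
  let ext : Set α → Finset (Set α) := fun A => (hclfin A).toFinset.image (fun x => insert x A)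
  let T : Finset (Set α) := h𝒜fin.toFinset.biUnion ext
  have hsub : {B : Set α | B ⊆ M.E ∧ B.ncard = k + 1 ∧ M.eRk B ≤ 3 ∧ ∃ A ∈ 𝒜, A ⊆ B} ⊆ ↑T := by
    rintro B ⟨hBE, hBk, hBr, A, hA, hAB⟩
    obtain ⟨hAE, hAr, hAk⟩ := h𝒜 A hA
    have hBfin : B.Finite := M.ground_finite.subset hBE
    have hdiff : (B \ A).ncard = 1 := by
      rw [Set.ncard_sdiff hAB (hBfin.subset hAB)]
      omega
    obtain ⟨x, hx⟩ := Set.ncard_eq_one.1 hdiff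
    have hxBA : x ∈ B \ A := by rw [hx]; exact rfl
    have hBeq : B = insert x A := by
      ext y
      constructor
      · intro hy
        by_cases hyA : y ∈ A
        · exact Or.inr hyA
        · have : y ∈ B \ A := ⟨hy, hyA⟩
          rw [hx] at this
          exact Or.inl this
      · rintro (rfl | hyA)
        · exact hxBA.1
        · exact hAB hyA
    have hcl : M.closure A = M.closure B :=
      (M.isRkFinite_of_finite (hBfin.subset hAB)).closure_eq_closure_of_subset_of_eRk_ge_eRk hAB
        (by rw [hAr]; exact hBr)
    have hxcl : x ∈ M.closure A \ A := ⟨hcl ▸ M.subset_closure B hBE hxBA.1, hxBA.2⟩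
    rw [Finset.mem_coe, Finset.mem_biUnion]
    refine ⟨A, h𝒜fin.mem_toFinset.2 hA, ?_⟩
    rw [Finset.mem_image]
    exact ⟨x, (hclfin A).mem_toFinset.2 hxcl, hBeq.symm⟩
  have hcard : T.card ≤ (7 - k) * 𝒜.ncard := by
    calc T.card ≤ ∑ A ∈ h𝒜fin.toFinset, (ext A).card := Finset.card_biUnion_le
      _ ≤ ∑ A ∈ h𝒜fin.toFinset, (7 - k) := by
          apply Finset.sum_le_sum
          intro A hA
          rw [h𝒜fin.mem_toFinset] at hA
          obtain ⟨hAE, hAr, hAk⟩ := h𝒜 A hA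
          calc (ext A).card ≤ (hclfin A).toFinset.card := Finset.card_image_le
            _ = (M.closure A \ A).ncard := (Set.ncard_eq_toFinset_card _ (hclfin A)).symm
            _ ≤ 7 - k := by
                have h7 : (M.closure A).ncard ≤ 7 :=
                  ThmN.ncard_le_seven_of_eRk_three M hs hfree (M.closure_subset_ground A)
                    (by rw [M.eRk_closure_eq]; exact hAr)
                rw [Set.ncard_sdiff (M.subset_closure A hAE) (M.ground_finite.subset hAE)]
                omega
      _ = (7 - k) * 𝒜.ncard := by
          rw [Finset.sum_const, smul_eq_mul, Set.ncard_eq_toFinset_card _ h𝒜fin, mul_comm]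
  calc {B : Set α | B ⊆ M.E ∧ B.ncard = k + 1 ∧ M.eRk B ≤ 3 ∧ ∃ A ∈ 𝒜, A ⊆ B}.ncard
      ≤ (↑T : Set (Set α)).ncard := Set.ncard_le_ncard hsub T.finite_toSet
    _ = T.card := Set.ncard_coe_finset T
    _ ≤ (7 - k) * 𝒜.ncard := hcard

/-- A `5`-set of rank `≤ 3` containing no `4`-circuit contains a triangle: any `4`-subset is dependent, hence
contains a circuit, which has `3` elements. -/
theorem exists_triangle_subset_of_no_four_circuit [M.Finite]
    (hcirc : ∀ C, M.IsCircuit C → 3 ≤ C.encard) {B : Set α} (hBE : B ⊆ M.E) (hB5 : B.ncard = 5)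
    (hBr : M.eRk B ≤ 3) (hno : ∀ C ∈ circuitsEq M 4, ¬ C ⊆ B) : ∃ ℓ ∈ circuitsEq M 3, ℓ ⊆ B := by
  have hBfin : B.Finite := M.ground_finite.subset hBE
  obtain ⟨x, hx⟩ : B.Nonempty := by rw [← Set.ncard_pos hBfin]; omega
  have hB'4 : (B \ {x}).ncard = 4 := by rw [Set.ncard_sdiff_singleton_of_mem hx]; omega
  have hB'E : B \ {x} ⊆ M.E := sdiff_subset.trans hBE
  have hB'fin : (B \ {x}).Finite := hBfin.subset sdiff_subset
  have hdep : M.Dep (B \ {x}) := by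
    refine ⟨fun hind => ?_, hB'E⟩
    have h4 : M.eRk (B \ {x}) ≤ 3 := (M.eRk_mono sdiff_subset).trans hBr
    rw [hind.eRk_eq_encard, ← hB'fin.cast_ncard_eq, hB'4] at h4
    exact absurd h4 (by norm_num)
  obtain ⟨C, hCB', hC⟩ := hdep.exists_isCircuit_subset
  have hCfin : C.Finite := hB'fin.subset hCB'
  have hC3 : 3 ≤ C.ncard := by
    have := hcirc C hC
    rw [← hCfin.cast_ncard_eq] at this
    exact_mod_cast this
  have hC4 : C.ncard ≤ 4 := (Set.ncard_le_ncard hCB' hB'fin).trans hB'4.le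
  rcases (show C.ncard = 3 ∨ C.ncard = 4 by omega) with h3 | h4
  · exact ⟨C, ⟨hC, h3⟩, hCB'.trans sdiff_subset⟩
  · exact absurd (hCB'.trans sdiff_subset) (hno C ⟨hC, h4⟩)

/-- **The fan count**: inside `S` with `|S| = r(S) + ν`, the `5`-sets of rank `3` containing a given triangle `ℓ ⊆ S`
number at most `6·(ν − 1)` — each lies in a plane section of `S` through `ℓ` with `≥ 5` points (at most `ν − 1` of
them, pairwise meeting in `ℓ`), and is `ℓ` plus a pair of the `≤ 4` further points of that section. -/
theorem ncard_fiveSets_through_triangle_le [M.Finite]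
    (hs : ∀ e ∈ M.E, ∀ f ∈ M.E, e ≠ f → M.eRk {e, f} = 2)
    (hfree : ∀ e ∈ M.E, ∃ A ⊆ M.E \ {e}, e ∉ M.closure A ∧ e ∉ M.closure ((M.E \ {e}) \ A))
    {S : Set α} (hS : S ⊆ M.E) {ν : ℕ} (hν : S.encard = M.eRk S + ν) {ℓ : Set α} (hℓS : ℓ ⊆ S)
    (hℓ3 : ℓ.ncard = 3) (hℓr : M.eRk ℓ = 2) :
    {B : Set α | B ⊆ S ∧ B.ncard = 5 ∧ M.eRk B = 3 ∧ ℓ ⊆ B}.ncard ≤ 6 * (ν - 1) := by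
  classical
  have hSfin : S.Finite := M.ground_finite.subset hS
  set 𝓑 := {B : Set α | B ⊆ S ∧ B.ncard = 5 ∧ M.eRk B = 3 ∧ ℓ ⊆ B} with h𝓑
  have h𝓑fin : 𝓑.Finite := hSfin.finite_subsets.subset (fun B hB => hB.1)
  have hC1 : ∀ L ⊆ M.E, M.eRk L = 2 → L.ncard ≤ 3 :=
    fun L hL hr => ThmN.ncard_le_three_of_eRk_two M hs hfree hL hr
  let f : Set α → Set α := fun B => M.closure B ∩ S
  let s : Finset (Set α) := h𝓑fin.toFinset.image f
  have hmem : ∀ Q ∈ s, ∃ B ∈ 𝓑, f B = Q := by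
    intro Q hQ
    rw [Finset.mem_image] at hQ
    obtain ⟨B, hB, rfl⟩ := hQ
    exact ⟨B, h𝓑fin.mem_toFinset.1 hB, rfl⟩
  have hBQ : ∀ B ∈ 𝓑, B ⊆ f B := fun B hB =>
    subset_inter (M.subset_closure B (hB.1.trans hS)) hB.1
  have hsS : ∀ Q ∈ s, Q ⊆ S := by
    intro Q hQ
    obtain ⟨B, -, rfl⟩ := hmem Q hQ
    exact inter_subset_right
  have hsr : ∀ Q ∈ s, M.eRk Q = 3 := by
    intro Q hQ
    obtain ⟨B, hB, rfl⟩ := hmem Q hQ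
    refine le_antisymm ?_ ?_
    · calc M.eRk (M.closure B ∩ S) ≤ M.eRk (M.closure B) := M.eRk_mono inter_subset_left
        _ = M.eRk B := M.eRk_closure_eq B
        _ = 3 := hB.2.2.1
    · rw [← hB.2.2.1]
      exact M.eRk_mono (hBQ B hB)
  have hs5 : ∀ Q ∈ s, 5 ≤ Q.ncard := by
    intro Q hQ
    obtain ⟨B, hB, rfl⟩ := hmem Q hQ
    rw [← hB.2.1]
    exact Set.ncard_le_ncard (hBQ B hB) (hSfin.subset inter_subset_right)
  have hsℓ : ∀ Q ∈ s, ℓ ⊆ Q := by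
    intro Q hQ
    obtain ⟨B, hB, rfl⟩ := hmem Q hQ
    exact hB.2.2.2.trans (hBQ B hB)
  have hpair : ∀ Q ∈ s, ∀ Q' ∈ s, Q ≠ Q' → Q ∩ Q' = ℓ := by
    intro Q hQ Q' hQ' hne
    obtain ⟨B, hB, rfl⟩ := hmem Q hQ
    obtain ⟨B', hB', rfl⟩ := hmem Q' hQ'
    exact ThmN.inter_planeSections_eq_of_ne M hC1 hS hℓS hℓ3 hℓr hB.2.2.1 hB'.2.2.1
      (hB.2.2.2.trans (M.subset_closure B (hB.1.trans hS)))
      (hB'.2.2.2.trans (M.subset_closure B' (hB'.1.trans hS))) hne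
  have hfan := ThmN.card_fan_add_one_le M hS hν hℓS hℓ3 hℓr s hsS hsr hs5 hsℓ hpair
  -- the fibres of `f` have at most `6` elements
  have hfib : ∀ Q ∈ s, (h𝓑fin.toFinset.filter (fun B => f B = Q)).card ≤ 6 := by
    intro Q hQ
    have hQS : Q ⊆ S := hsS Q hQ
    have hQfin : Q.Finite := hSfin.subset hQS
    have hQ7 : Q.ncard ≤ 7 :=
      ThmN.ncard_le_seven_of_eRk_three M hs hfree (hQS.trans hS) (hsr Q hQ)
    have hℓQ : ℓ ⊆ Q := hsℓ Q hQ
    have hQℓ : (Q \ ℓ).ncard ≤ 4 := by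
      rw [Set.ncard_sdiff hℓQ (hQfin.subset hℓQ)]
      omega
    -- `B ↦ B ∖ ℓ` is injective on the fibre and lands in the `2`-subsets of `Q ∖ ℓ`
    have hinj : Set.InjOn (fun B : Set α => B \ ℓ) {B | B ∈ 𝓑 ∧ f B = Q} := by
      intro B hB B' hB' hBB'
      simp only at hBB'
      have h1 : B = (B \ ℓ) ∪ ℓ := (Set.sdiff_union_of_subset hB.1.2.2.2).symm
      have h2 : B' = (B' \ ℓ) ∪ ℓ := (Set.sdiff_union_of_subset hB'.1.2.2.2).symm
      rw [h1, h2, hBB']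
    have hmaps : ∀ B ∈ {B | B ∈ 𝓑 ∧ f B = Q},
        (fun B : Set α => B \ ℓ) B ∈ {D | D ⊆ Q \ ℓ ∧ D.ncard = 2} := by
      rintro B ⟨hB, hfB⟩
      refine ⟨?_, ?_⟩
      · intro y hy
        exact ⟨hfB ▸ hBQ B hB hy.1, hy.2⟩
      · rw [Set.ncard_sdiff hB.2.2.2 (hSfin.subset (hB.2.2.2.trans hB.1)), hB.2.1, hℓ3]
    have hfinD : {D : Set α | D ⊆ Q \ ℓ ∧ D.ncard = 2}.Finite :=
      (hQfin.subset sdiff_subset).finite_subsets.subset (fun D hD => hD.1)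
    have hset : {B | B ∈ 𝓑 ∧ f B = Q} = ↑(h𝓑fin.toFinset.filter (fun B => f B = Q)) := by
      ext B
      simp only [mem_setOf_eq, Finset.coe_filter, h𝓑fin.mem_toFinset]
    calc (h𝓑fin.toFinset.filter (fun B => f B = Q)).card
        = {B | B ∈ 𝓑 ∧ f B = Q}.ncard := by rw [hset, Set.ncard_coe_finset]
      _ ≤ {D : Set α | D ⊆ Q \ ℓ ∧ D.ncard = 2}.ncard :=
          Set.ncard_le_ncard_of_injOn _ hmaps hinj hfinD
      _ = (Q \ ℓ).ncard.choose 2 := Set.ncard_powerset_ncard (hQfin.subset sdiff_subset) 2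
      _ ≤ Nat.choose 4 2 := Nat.choose_le_choose 2 hQℓ
      _ = 6 := by norm_num [Nat.choose_two_right]
  have hmaps' : ∀ B ∈ h𝓑fin.toFinset, f B ∈ s := fun B hB => Finset.mem_image_of_mem f hB
  have h := Finset.card_le_mul_card_image_of_maps_to hmaps' 6 hfib
  rw [← Set.ncard_eq_toFinset_card _ h𝓑fin] at h
  calc 𝓑.ncard ≤ 6 * s.card := h
    _ ≤ 6 * (ν - 1) := by
        apply Nat.mul_le_mul_left
        omega

end Matroid

end PercRepro
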